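import Summits.ResolutionOfSingularities.ResolutionOfSingularities.Theses.RuledResidues

/-!
# Crux `NonRuledDivisors` (stmt-ResolutionOfSingularities-18075), line `automorphism-orbit` —
# engine (B) of `stub_orbitGerm` needs constants TRANSCENDENTAL over the prime field

The second injectivity certificate of `stub_orbitGerm` (engine B, "transcendental modulus") is
`∃ x a, τ x = x ∧ (∀ n > 0, ιⁿ a ≠ a) ∧ x − a ∈ 𝔪_W`, with `τ` a ring automorphism of `K`
semilinear over a ring automorphism `ι` of the ground field `k` (characteristic `p`).

Negative-side support (crux disprover, cycle 1), sorry-free, definition-free, resolution-free: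

* `orbitGerm_exists_pow_apply_eq_of_root` — if `a ∈ k` is a root of a nonzero polynomial over
  `𝔽_p = ZMod p`, then every ring automorphism `ι` of `k` has a FINITE orbit through `a`
  (`ιⁿ a = a` for some `n ≥ 1`): the orbit consists of roots of that polynomial, because `ι` fixes
  the prime field (`Subsingleton (ZMod p →+* k)`).
* `orbitGerm_engineB_false_of_algebraic_constants` — hence over a field `k` all of whose elements are
  algebraic over `𝔽_p` (finite fields, `𝔽̄_p`, any subfield of it) the engine-(B) disjunct of
  `stub_orbitGerm` (verbatim) is impossible, whatever `τ`, `x`, `W`.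

Moral for hunters: an engine-(B) germ lives over a ground field containing an element transcendental
over `𝔽_p` (the strategist's habitat `k ⊋ 𝔽̄_p(a)`), never over `𝔽̄_p` twisted by Frobenius or
any Galois action alone; combined with the card's Ohm obstruction (separably closed `k` ⇒ ruled),
the modulus must be a transcendental whose inseparable residue growth makes `κ(W)` non-ruled.
This file does NOT refute the crux or the stub (it removes a habitat).
-/

set_option linter.dupNamespace false

namespace Summit.ResolutionOfSingularities.ResolutionOfSingularities.Theorems

/-- **Automorphism orbits of algebraic elements are finite.**  If `a ∈ k` (`char k = p` prime) is a
root of a nonzero `f ∈ 𝔽_p[X]`, then for every ring automorphism `ι` of `k` some positive iterate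
fixes `a`. [folklore] -/
theorem orbitGerm_exists_pow_apply_eq_of_root {p : ℕ} [Fact p.Prime] {k : Type*} [Field k]
    [CharP k p] (ι : k ≃+* k) (a : k)
    (ha : ∃ f : Polynomial (ZMod p), f ≠ 0 ∧ Polynomial.eval₂ (ZMod.castHom (dvd_refl p) k) a f = 0) :
    ∃ n : ℕ, 0 < n ∧ (ι ^ n) a = a := by
  classical
  obtain ⟨f, hf, hfa⟩ := ha
  set φ : ZMod p →+* k := ZMod.castHom (dvd_refl p) k with hφ_def
  -- every iterate of `a` is again a root of `f`
  have hroot : ∀ n : ℕ, Polynomial.eval₂ φ ((ι ^ n) a) f = 0 := by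
    intro n
    induction n with
    | zero => simpa using hfa
    | succ n ih =>
      rw [pow_succ', RingAut.mul_apply]
      have hcomp : (ι : k →+* k).comp φ = φ := Subsingleton.elim _ _
      have h := Polynomial.hom_eval₂ f φ (ι : k →+* k) ((ι ^ n) a)
      rw [hcomp, ih, map_zero] at h
      exact h.symm
  -- the roots of `f` in `k` form a finite set
  have hφ : Function.Injective φ := φ.injective
  have hne : f.map φ ≠ 0 := (Polynomial.map_ne_zero_iff hφ).mpr hf
  have hfin : Set.Finite {x : k | Polynomial.eval₂ φ x f = 0} := by
    refine (f.map φ).roots.toFinset.finite_toSet.subset ?_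
    intro x hx
    simp only [Set.mem_setOf_eq] at hx
    simp only [Finset.mem_coe, Multiset.mem_toFinset, Polynomial.mem_roots hne, Polynomial.IsRoot.def,
      Polynomial.eval_map]
    exact hx
  -- so the orbit map is not injective
  have hnotinj : ¬ Function.Injective (fun n : ℕ => (ι ^ n) a) := fun hinj =>
    Set.infinite_of_injective_forall_mem hinj (fun n => hroot n) hfin
  rw [Function.Injective] at hnotinj
  push Not at hnotinj
  obtain ⟨m, n, hmn, hne'⟩ := hnotinj
  rcases Nat.lt_or_gt_of_ne hne' with h | h
  · refine ⟨n - m, Nat.sub_pos_of_lt h, ?_⟩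
    apply (ι ^ m).injective
    rw [← RingAut.mul_apply, ← pow_add, Nat.add_sub_cancel' h.le]
    exact hmn.symm
  · refine ⟨m - n, Nat.sub_pos_of_lt h, ?_⟩
    apply (ι ^ n).injective
    rw [← RingAut.mul_apply, ← pow_add, Nat.add_sub_cancel' h.le]
    exact hmn

/-- **Engine (B) of `stub_orbitGerm` is void over constants algebraic over `𝔽_p`.**  If every
element of `k` is a root of a nonzero polynomial over `ZMod p`, the modulus certificate (second
disjunct of `stub_orbitGerm`, verbatim) fails for all `τ`, `ι`, `W`. [folklore] -/
theorem orbitGerm_engineB_false_of_algebraic_constants {p : ℕ} (hp : p.Prime) {k K : Type}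
    [Field k] [CharP k p] [Field K] [Algebra k K]
    (halg : ∀ a : k, ∃ f : Polynomial (ZMod p), f ≠ 0 ∧
      Polynomial.eval₂ (ZMod.castHom (dvd_refl p) k) a f = 0)
    (τ : K ≃+* K) (ι : k ≃+* k) (W : ValuationSubring K) :
    ¬ (∃ (x : K) (a : k), τ x = x ∧ (∀ n : ℕ, 0 < n → (ι ^ n) a ≠ a) ∧
        x - algebraMap k K a ∈ W.nonunits) := by
  rintro ⟨x, a, -, horb, -⟩
  haveI : Fact p.Prime := ⟨hp⟩
  obtain ⟨n, hn, hfix⟩ := orbitGerm_exists_pow_apply_eq_of_root ι a (halg a)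
  exact horb n hn hfix

end Summit.ResolutionOfSingularities.ResolutionOfSingularities.Theorems
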